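import Summits.Ventures.DiscreteObjects.Hadamard.NormalizerOrbitTools
import Summits.Ventures.DiscreteObjects.Hadamard.GSRowSums167

/-!
# Normalisers of prime-order elements of Aut± of a Hadamard matrix: the sequence family of a free row is translation-twisted
# multiplier-invariant (kernel, general prime `p`, any order)

Framing: lottery ticket; floor = certified bounds/negative ranges.

Cell pub-namedobj (venture DiscreteObjects), target (H), hadamard gen 20.  The common core of the order-167 / order-83 normaliser
theorems, for an arbitrary Hadamard matrix `H` (any order) and an odd prime `p`: let `σ = (π, κ, d, e)` be a signed automorphism with
`π^p = κ^p = 1`, `(π, κ) ≠ (1, 1)`, and `τ = (π', κ', d', e')` a signed automorphism NORMALISING it with multiplier `μ` (`π'π = π^μ π'`,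
`κ'κ = κ^μ κ'`) that keeps a free row `x₀` and every free column inside its `σ`-orbit.  Then (**`normalizing_prime_main`**) there are a
unit `u ≡ μ (mod p)`, a transversal `T` of the free column orbits (`p·|T| = #{κ y ≠ y}`) and `±1` sequences `x_y : ZMod p → ℤ` (`y ∈ T`;
`x_y(t) = H'(x₀, κ^t y)` for the re-signed matrix `H'`) with `Σ_{y∈T} PAF(x_y)(s) = −#Fix κ` for every `s ≠ 0` (the cyclic-core identity,
gen 19) and each `x_y` translation-twisted `u`-invariant (`x_y(u t + γ_y) = x_y(t)`).  [Re-sign `σ` to a permutation pair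
(`ResignOddOrder`); the signs of `τ` on `H'` satisfy `d₁(πx)e₁(κy) = d₁(x)e₁(y)`, so `d₁(πx) = λ d₁(x)` with a constant `λ = ±1` and
`λ^p = 1`, `p` odd ⇒ `λ = 1`; the affine relation comes from `H'(π'x₀, κ'(κ^k y)) = d₁(x₀)e₁(y)H'(x₀, κ^k y)` with `π'x₀ = π^c x₀`,
`κ'(κ^k y) = κ^{μk} κ' y`, `κ' y = κ^j y`; its sign is `+` because `Σ_t x_y(t)` is odd.]  Instances: `p = 167` (|T| = 4, Σ = 0: a
Goethals–Seidel family), `p = 83` (|T| = 8, Σ = −4), `p = 37` (18, −2), `p = 23` (29, −1 or 28, −24).  Structure lemma; nothing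
about H(668) is excluded here.  Ours; no `sorry`, no definitions.
-/

namespace Summit.Ventures.DiscreteObjects.Hadamard

open Finset BigOperators Matrix

open Literature.Combinatorics.Designs.GoethalsSeidel (IsHadamardMatrix)
open Literature.Combinatorics.Designs.LegendrePairs (PAF IsPM TwistedInvariant)

variable {ι : Type*} [Fintype ι] [DecidableEq ι] {H : Matrix ι ι ℤ}

/-- **Main lemma (prime order, block-preserving normaliser).**  See the module docstring. -/
theorem normalizing_prime_main {p : ℕ} [NeZero p] (hp : p.Prime) (hodd : Odd p) (hH : IsHadamardMatrix H)
    {π κ π' κ' : Equiv.Perm ι} {d e d' e' : ι → ℤ} (haut : IsSignedAut H π κ d e)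
    (hπ : π ^ p = 1) (hκ : κ ^ p = 1) (hne : π ≠ 1 ∨ κ ≠ 1)
    (haut' : IsSignedAut H π' κ' d' e') {μ : ℕ} (hnπ : π' * π = π ^ μ * π') (hnκ : κ' * κ = κ ^ μ * κ')
    {x₀ : ι} (hx₀ : π x₀ ≠ x₀) (hrow : π' x₀ ∈ orbFin π p x₀) (hcols : ∀ y, κ y ≠ y → κ' y ∈ orbFin κ p y) :
    ∃ (u : (ZMod p)ˣ) (T : Finset ι) (x : ι → ZMod p → ℤ), (u : ZMod p) = (μ : ZMod p) ∧
      p * T.card = (univ.filter fun y => κ y ≠ y).card ∧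
      (∀ y ∈ T, IsPM (x y)) ∧
      (∀ s : ZMod p, s ≠ 0 → ∑ y ∈ T, PAF (x y) s = -((univ.filter fun y => κ y = y).card : ℤ)) ∧
      ∀ y ∈ T, TwistedInvariant (x y) u := by
  have hp0 : 0 < p := hp.pos
  have hCfree : ∀ y, κ y ≠ y → ∀ k, 0 < k → k < p → (κ ^ k) y ≠ y :=
    fun y hy => free_of_fixed_prime_pow κ hp (by rw [hκ, Equiv.Perm.one_apply]) hy
  have hx₀free : ∀ k, 0 < k → k < p → (π ^ k) x₀ ≠ x₀ :=
    free_of_fixed_prime_pow π hp (by rw [hπ, Equiv.Perm.one_apply]) hx₀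
  -- the multiplier is prime to p
  have hcop : Nat.Coprime μ p := by
    refine (Nat.Coprime.symm ((Nat.Prime.coprime_iff_not_dvd hp).mpr ?_))
    rintro ⟨m, rfl⟩
    have hπ1 : π = 1 := by
      have h1 := hnπ
      rw [pow_mul, hπ, one_pow, one_mul] at h1
      have h2 : π' * π = π' * 1 := by rw [h1, mul_one]
      exact mul_left_cancel h2
    have hκ1 : κ = 1 := by
      have h1 := hnκ
      rw [pow_mul, hκ, one_pow, one_mul] at h1
      have h2 : κ' * κ = κ' * 1 := by rw [h1, mul_one]
      exact mul_left_cancel h2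
    rcases hne with h | h
    · exact h hπ1
    · exact h hκ1
  set u : (ZMod p)ˣ := ZMod.unitOfCoprime μ hcop with hudef
  have hu : (u : ZMod p) = (μ : ZMod p) := ZMod.coe_unitOfCoprime μ hcop
  -- re-sign: σ becomes a permutation pair of H'
  obtain ⟨s, t, hs, ht, hH', hinv⟩ := exists_resign_of_odd hH haut hodd hπ hκ
  set H' : Matrix ι ι ℤ := Matrix.of fun i j => s i * t j * H i j with hH'def
  have hinv' : ∀ i j, H' (π i) (κ j) = H' i j := fun i j => by simp only [hH'def, Matrix.of_apply]; exact hinv i j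
  have hinvm : ∀ m i j, H' ((π ^ m) i) ((κ ^ m) j) = H' i j := perm_aut_pow hinv'
  -- τ on H'
  set d₁ : ι → ℤ := fun i => s (π' i) * s i * d' i with hd₁
  set e₁ : ι → ℤ := fun j => t (κ' j) * t j * e' j with he₁
  have hτ : ∀ i j, H' (π' i) (κ' j) = d₁ i * e₁ j * H' i j := by
    intro i j
    simp only [hH'def, Matrix.of_apply, hd₁, he₁]
    rw [haut'.2.2 i j]
    have h1 := pm_mul_self (hs i); have h2 := pm_mul_self (ht j)
    calc s (π' i) * t (κ' j) * (d' i * e' j * H i j)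
        = s (π' i) * t (κ' j) * (d' i * e' j * H i j) * ((s i * s i) * (t j * t j)) := by rw [h1, h2]; ring
      _ = s (π' i) * s i * d' i * (t (κ' j) * t j * e' j) * (s i * t j * H i j) := by ring
  have hd₁pm : ∀ i, d₁ i = 1 ∨ d₁ i = -1 := fun i => by
    rcases hs (π' i) with h1 | h1 <;> rcases hs i with h2 | h2 <;> rcases haut'.1 i with h3 | h3 <;> simp [hd₁, h1, h2, h3]
  have he₁pm : ∀ j, e₁ j = 1 ∨ e₁ j = -1 := fun j => by
    rcases ht (κ' j) with h1 | h1 <;> rcases ht j with h2 | h2 <;> rcases haut'.2.1 j with h3 | h3 <;> simp [he₁, h1, h2, h3]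
  have hH'ne : ∀ i j, H' i j ≠ 0 := fun i j => pm_ne_zero (hH'.1 i j)
  -- sign constancy along σ-cycles (the ratio λ is constant with λ^p = 1, p odd)
  have key : ∀ x y, d₁ (π x) * e₁ (κ y) * H' x y = d₁ x * e₁ y * H' x y := by
    intro x y
    have h1 : H' (π' (π x)) (κ' (κ y)) = d₁ (π x) * e₁ (κ y) * H' x y := by rw [hτ, hinv']
    rw [norm_apply hnπ x, norm_apply hnκ y, hinvm, hτ] at h1
    exact h1.symm
  have hlam : ∀ x, d₁ (π x) = (e₁ x₀ * e₁ (κ x₀)) * d₁ x := by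
    intro x
    have h := key x x₀
    have hne0 : H' x x₀ ≠ 0 := hH'ne x x₀
    have h2 : d₁ (π x) * e₁ (κ x₀) = d₁ x * e₁ x₀ := by
      have : (d₁ (π x) * e₁ (κ x₀) - d₁ x * e₁ x₀) * H' x x₀ = 0 := by linarith
      rcases mul_eq_zero.mp this with h0 | h0
      · linarith
      · exact (hne0 h0).elim
    calc d₁ (π x) = d₁ (π x) * (e₁ (κ x₀) * e₁ (κ x₀)) := by rw [pm_mul_self (he₁pm _), mul_one]
      _ = (d₁ (π x) * e₁ (κ x₀)) * e₁ (κ x₀) := by ring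
      _ = (e₁ x₀ * e₁ (κ x₀)) * d₁ x := by rw [h2]; ring
  have hlampm : e₁ x₀ * e₁ (κ x₀) = 1 ∨ e₁ x₀ * e₁ (κ x₀) = -1 := by
    rcases he₁pm x₀ with h1 | h1 <;> rcases he₁pm (κ x₀) with h2 | h2 <;> simp [h1, h2]
  have hlampow : ∀ k x, d₁ ((π ^ k) x) = (e₁ x₀ * e₁ (κ x₀)) ^ k * d₁ x := by
    intro k; induction k with
    | zero => intro x; simp
    | succ k ih => intro x; rw [pow_succ', Equiv.Perm.mul_apply, hlam, ih, pow_succ]; ring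
  have hlam1 : e₁ x₀ * e₁ (κ x₀) = 1 := by
    rcases hlampm with h | h
    · exact h
    · exfalso
      have h1 := hlampow p x₀
      rw [hπ, Equiv.Perm.one_apply, h, Odd.neg_one_pow hodd] at h1
      exact pm_ne_zero (hd₁pm x₀) (by linarith)
  have hdπ : ∀ x, d₁ (π x) = d₁ x := fun x => by rw [hlam, hlam1, one_mul]
  have heκ : ∀ y, e₁ (κ y) = e₁ y := by
    intro y
    have h := key x₀ y
    rw [hdπ] at h
    have hne0 : d₁ x₀ * H' x₀ y ≠ 0 := mul_ne_zero (pm_ne_zero (hd₁pm x₀)) (hH'ne x₀ y)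
    have : (e₁ (κ y) - e₁ y) * (d₁ x₀ * H' x₀ y) = 0 := by linarith
    rcases mul_eq_zero.mp this with h0 | h0
    · linarith
    · exact (hne0 h0).elim
  have heκpow : ∀ k y, e₁ ((κ ^ k) y) = e₁ y := by
    intro k; induction k with
    | zero => intro y; simp
    | succ k ih => intro y; rw [pow_succ', Equiv.Perm.mul_apply, heκ, ih]
  -- π' x₀ = π^c x₀
  obtain ⟨c, hcp, hc⟩ := Finset.mem_image.mp hrow
  rw [Finset.mem_range] at hcp
  -- the column transversal
  have hstab : ∀ y ∈ univ.filter (fun y => κ y ≠ y), κ y ∈ univ.filter (fun y => κ y ≠ y) := by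
    intro y hy; rw [Finset.mem_filter] at hy ⊢; exact ⟨Finset.mem_univ _, fun h => hy.2 (κ.injective h)⟩
  obtain ⟨T, hTsub, hTc, hT⟩ := exists_free_transversal κ hp0 _ (univ.filter fun y => κ y ≠ y) le_rfl
    hstab (fun y _ => by rw [hκ, Equiv.Perm.one_apply]) (fun y hy => hCfree y (Finset.mem_filter.mp hy).2)
  -- the sequences
  set x : ι → ZMod p → ℤ := fun y r => H' x₀ ((κ ^ r.val) y) with hx
  have hpafx : ∀ y (z : ZMod p), PAF (x y) z = ∑ k ∈ Finset.range p, H' x₀ ((κ ^ k) y) * H' x₀ ((κ ^ (k + z.val)) y) := by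
    intro y z
    unfold PAF
    have hterm : ∀ r : ZMod p, x y r * x y (r + z) = H' x₀ ((κ ^ r.val) y) * H' x₀ ((κ ^ (r.val + z.val)) y) := by
      intro r; simp only [hx]; rw [ZMod.val_add, pow_mod_of_pow_eq_one κ hκ]
    simp only [hterm]
    exact sum_zmod_val_eq_sum_range (fun k => H' x₀ ((κ ^ k) y) * H' x₀ ((κ ^ (k + z.val)) y))
  have hgs : ∀ z : ZMod p, z ≠ 0 → ∑ y ∈ T, PAF (x y) z = -((univ.filter fun y => κ y = y).card : ℤ) := by
    intro z hz
    obtain ⟨hz0, hzn⟩ := zmod_val_pos_of_ne_zero hz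
    have hid := cyclicCore_paf_identity hH' hinv' hπ T hT hx₀free hz0 hzn
    rw [Finset.sum_congr rfl fun y _ => hpafx y z]
    exact hid
  -- the affine relation along each column cycle
  have hrel : ∀ (y : ι) (j : ℕ), κ' y = (κ ^ j) y → ∀ k : ℕ,
      H' x₀ ((κ ^ (μ * k + (j + (p - c)))) y) = d₁ x₀ * e₁ y * H' x₀ ((κ ^ k) y) := by
    intro y j hyj k
    have h1 := hτ x₀ ((κ ^ k) y)
    rw [heκpow, ← hc, norm_apply_pow hnκ k y, hyj, ← Equiv.Perm.mul_apply, ← pow_add] at h1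
    have h2 : H' ((π ^ c) x₀) ((κ ^ (μ * k + j)) y) = H' x₀ ((κ ^ (μ * k + (j + (p - c)))) y) := by
      have ee : κ ^ (μ * k + j) = κ ^ c * κ ^ (μ * k + (j + (p - c))) := by
        rw [← pow_add, show c + (μ * k + (j + (p - c))) = (μ * k + j) + p by omega, pow_add κ (μ * k + j) p, hκ, mul_one]
      rw [ee, Equiv.Perm.mul_apply, hinvm]
    rw [← h2, h1]
  have haff : ∀ (y : ι) (j : ℕ), κ' y = (κ ^ j) y → ∀ tt : ZMod p,
      x y ((u : ZMod p) * tt + ((j + (p - c) : ℕ) : ZMod p)) = d₁ x₀ * e₁ y * x y tt := by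
    intro y j hyj tt
    simp only [hx]
    rw [← hrel y j hyj tt.val]
    congr 2
    apply pow_eq_pow_of_natCast_eq_n hκ
    rw [ZMod.natCast_zmod_val, hu, Nat.cast_add (μ * tt.val), Nat.cast_mul, ZMod.natCast_zmod_val]
  have hηpm : ∀ y, d₁ x₀ * e₁ y = 1 ∨ d₁ x₀ * e₁ y = -1 := fun y => by
    rcases hd₁pm x₀ with h1 | h1 <;> rcases he₁pm y with h2 | h2 <;> simp [h1, h2]
  refine ⟨u, T, x, hu, hTc, fun y _ r => hH'.1 _ _, hgs, fun y hyT => ?_⟩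
  obtain ⟨j, -, hj⟩ := Finset.mem_image.mp (hcols y (Finset.mem_filter.mp (hTsub hyT)).2)
  have hA := haff y j hj.symm
  have hsum : ∑ r, x y r ≠ 0 := by
    obtain ⟨m, hm⟩ := rowsum_odd (x y) (fun r => hH'.1 _ _) hodd
    rw [hm]; omega
  have hη := eta_eq_one_of_affine (x y) u _ (hηpm y) hA hsum
  rw [hη] at hA
  simp only [one_mul] at hA
  exact twisted_of_affine (x y) u _ hA

end Summit.Ventures.DiscreteObjects.Hadamard
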